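import Summits.ResolutionOfSingularities.ResolutionOfSingularities.Theorems.EquisingularLiftEquisingularLiftNatCarrierDeltaFlat
import Summits.ResolutionOfSingularities.ResolutionOfSingularities.Theorems.EquisingularLiftEquisingularLiftNatCarrierDeltaRegular
import Summits.ResolutionOfSingularities.ResolutionOfSingularities.Theorems.EquisingularLiftEquisingularLiftNatCarrierDeltaSectionFrame
import Summits.ResolutionOfSingularities.ResolutionOfSingularities.Theorems.EquisingularLiftEquisingularLiftNatCarrierDeltaConeIdeal
import HarnessLib

/-!
# [OURS · L1 W4.5(b)] T-CARRIER-Δ, ONE-THEOREM FORM: the Δ-centre of an `O`-cone form `Φ₀ ∈ O[T₁, …, T_n]` in given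
# coordinates — regular, flat over `O`, inside the exceptional divisor

Support file of the crux chain w45b (cell `res-hironaka`, LADDER-RESOLUTION rung L, slot W4.5(b)), working crux
**EL♮ = `Theses.EquisingularLift.EquisingularLiftNat`** (stmt-ResolutionOfSingularities-20038), registered stub
`stub_elnat_tcDeltaPointResolution`; supplier assembly HΔ(AdmTC) of res-D-pv-029's T-INST (p515248), sub-goals (S4)+(S5)
of res-type-100's HDeltaTC-skeleton. OURS; NOT a statement of any manuscript; AI-written, weaker than expert review. Filed
`--supports stmt-ResolutionOfSingularities-20038 --as helper`.

**`carrierDelta_clauses_of_coneForm`** composes the kit (p509910 stalks · p512232 flat · p513634 regular · p514592…p518540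
frame · p517178 cone ideal): INPUT — `O` a DVR with uniformizer `ϖ`, `q : P → Spec O` proper, `P` locally Noetherian and
regular at `p = s(s₀)` for a section `s`, `τ : X₁ → P` a blow-up along `ker s`, coordinates `c : Fin n → 𝒪_{P,p}` of the
section (`(c) = (ker s)_p`, `dim 𝒪_{P,p} = n + 1`), a FORM `Φ₀ ∈ O[T₁..T_n]` of degree `d` with `Φ₀ mod 𝔪_O ≠ 0`, and the
Δ-CRITERION in res-type-032's `_comp` currency (for every retraction `ρ` of `ι : O → 𝒪_{P,p}` — the wrapper supplies its own —,
every chart `j` and every prime `Q ∋ C ϖ` of `O[T_l : l ≠ j]/(ρ(ι Φ₀)(T_j := 1))`, the localisation is regular: exactly the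
conclusion of `exists_isHomogeneous_lift_deltaRegular_plane_comp` p516860); OUTPUT — for the cone
`K := ker (Spec (𝒪_{P,p}/(Φ₀(c))) → P)` and the Δ-centre `C := St_τ(K) ⊔ (ker s)·𝒪_{X₁}`: `V(C)` regular, `V(C) → Spec O` flat,
`supp C ⊆ supp E`, and `K_p = (Φ₀(c))`. The fourth clause of HΔ(AdmTC), `C.comap j₂ = Z`, is res-D-pv-029's (v).
-/

set_option linter.dupNamespace false -- mandated namespace `Summit.<Summit>.<Problem>` of this single-conjunct summit
set_option linter.overlappingInstances false -- signatures carry `[IsDomain O] [IsDiscreteValuationRing O]`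

noncomputable section

open CategoryTheory AlgebraicGeometry TopologicalSpace IsLocalRing Opposite
open Literature.AlgebraicGeometry.Resolution
open Summit.ResolutionOfSingularities.ResolutionOfSingularities.Cruxes.EquisingularLift.StrataSplit

namespace Summit.ResolutionOfSingularities.ResolutionOfSingularities.Cruxes.EquisingularLiftNat.Sections

variable (O : Type) [CommRing O] [IsDomain O] [IsDiscreteValuationRing O]

/-- A ring homomorphism out of a local ring that lands a constant in the maximal ideal had a non-unit constant: if
`map (residue O) Φ₀ ≠ 0` then `map (residue R) (map ι Φ₀) ≠ 0` for any `ι : O →+* R`. [folklore] -/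
theorem map_residue_map_ne_zero {R : Type} [CommRing R] [IsLocalRing R] (ι : O →+* R) {σ : Type*}
    {Φ₀ : MvPolynomial σ O} (hΦ₀ : MvPolynomial.map (IsLocalRing.residue O) Φ₀ ≠ 0) :
    MvPolynomial.map (IsLocalRing.residue R) (MvPolynomial.map ι Φ₀) ≠ 0 := by
  intro h0
  apply hΦ₀
  rw [MvPolynomial.map_map] at h0
  apply map_eq_zero_of_coeff_mem_ker
  intro m
  have hm := coeff_mem_ker_of_map_eq_zero _ h0 m
  rw [RingHom.mem_ker, RingHom.comp_apply, IsLocalRing.residue_eq_zero_iff] at hm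
  rw [RingHom.mem_ker, IsLocalRing.residue_eq_zero_iff, IsLocalRing.mem_maximalIdeal, mem_nonunits_iff]
  exact fun hu => (IsLocalRing.mem_maximalIdeal _).mp hm (hu.map ι)

/-- **T-CARRIER-Δ IN ONE THEOREM (clauses (b), (c) and `supp C ⊆ supp E` of a HorizChainE1 step / of HΔ(AdmTC)).**
See the module docstring. [cite: Hartshorne1977, III Prop. 9.7; Liu2002, Thm. 8.1.19] -/
theorem carrierDelta_clauses_of_coneForm {P X₁ : Scheme.{0}} [IsLocallyNoetherian P] (q : P ⟶ Spec (.of O))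
    [IsProper q] (s : Spec (.of O) ⟶ P) (hs : s ≫ q = 𝟙 _)
    (hreg : IsRegularLocalRing (P.presheaf.stalk (s (IsLocalRing.closedPoint O))))
    (τ : X₁ ⟶ P) (hτ : IsBlowup τ s.ker) (ϖ : O) (hϖ : Irreducible ϖ) {n : ℕ}
    (c : Fin n → P.presheaf.stalk (s (IsLocalRing.closedPoint O)))
    (hcI : Ideal.span (Set.range c) = stalkIdeal s.ker (s (IsLocalRing.closedPoint O)))
    (hdim : ringKrullDim (P.presheaf.stalk (s (IsLocalRing.closedPoint O))) = (n + 1 : ℕ))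
    {d : ℕ} (Φ₀ : MvPolynomial (Fin n) O) (hΦ₀d : Φ₀.IsHomogeneous d)
    (hΦ₀ : MvPolynomial.map (IsLocalRing.residue O) Φ₀ ≠ 0)
    (hΔ : ∀ (ρ : P.presheaf.stalk (s (IsLocalRing.closedPoint O)) →+* O),
      ρ.comp ((Scheme.ΓSpecIso (.of O)).inv ≫ q.appTop ≫ P.presheaf.Γgerm (s (IsLocalRing.closedPoint O))).hom =
        RingHom.id O →
      ∀ (j : Fin n) (Q : Ideal (MvPolynomial {l : Fin n // l ≠ j} O ⧸ Ideal.span {MvPolynomial.map ρ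
        (dehomogenize j (MvPolynomial.map
          ((Scheme.ΓSpecIso (.of O)).inv ≫ q.appTop ≫ P.presheaf.Γgerm (s (IsLocalRing.closedPoint O))).hom Φ₀))}))
        [Q.IsPrime],
        Ideal.Quotient.mk _ (MvPolynomial.C ϖ : MvPolynomial {l : Fin n // l ≠ j} O) ∈ Q →
          IsRegularLocalRing (Localization.AtPrime Q)) :
    Scheme.IsRegular (strictTransformIdeal τ s.ker
        (Spec.map (CommRingCat.ofHom (Ideal.Quotient.mk (Ideal.span {MvPolynomial.eval c (MvPolynomial.map
          ((Scheme.ΓSpecIso (.of O)).inv ≫ q.appTop ≫ P.presheaf.Γgerm (s (IsLocalRing.closedPoint O))).hom Φ₀)}))) ≫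
          P.fromSpecStalk (s (IsLocalRing.closedPoint O))).ker ⊔ s.ker.comap τ).subscheme ∧
      Flat ((strictTransformIdeal τ s.ker
        (Spec.map (CommRingCat.ofHom (Ideal.Quotient.mk (Ideal.span {MvPolynomial.eval c (MvPolynomial.map
          ((Scheme.ΓSpecIso (.of O)).inv ≫ q.appTop ≫ P.presheaf.Γgerm (s (IsLocalRing.closedPoint O))).hom Φ₀)}))) ≫
          P.fromSpecStalk (s (IsLocalRing.closedPoint O))).ker ⊔ s.ker.comap τ).subschemeι ≫ τ ≫ q) ∧
      (((strictTransformIdeal τ s.ker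
        (Spec.map (CommRingCat.ofHom (Ideal.Quotient.mk (Ideal.span {MvPolynomial.eval c (MvPolynomial.map
          ((Scheme.ΓSpecIso (.of O)).inv ≫ q.appTop ≫ P.presheaf.Γgerm (s (IsLocalRing.closedPoint O))).hom Φ₀)}))) ≫
          P.fromSpecStalk (s (IsLocalRing.closedPoint O))).ker ⊔ s.ker.comap τ).support : Set X₁) ⊆
        ((s.ker.comap τ).support : Set X₁)) ∧
      stalkIdeal (Spec.map (CommRingCat.ofHom (Ideal.Quotient.mk (Ideal.span {MvPolynomial.eval c (MvPolynomial.map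
          ((Scheme.ΓSpecIso (.of O)).inv ≫ q.appTop ≫ P.presheaf.Γgerm (s (IsLocalRing.closedPoint O))).hom Φ₀)}))) ≫
          P.fromSpecStalk (s (IsLocalRing.closedPoint O))).ker (s (IsLocalRing.closedPoint O)) =
        Ideal.span {MvPolynomial.eval c (MvPolynomial.map
          ((Scheme.ΓSpecIso (.of O)).inv ≫ q.appTop ≫ P.presheaf.Γgerm (s (IsLocalRing.closedPoint O))).hom Φ₀)} := by
  haveI : IsProper τ := hτ.isProper
  haveI : IsLocallyNoetherian X₁ := LocallyOfFiniteType.isLocallyNoetherian τ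
  haveI := hreg
  -- the frame for the given coordinates
  obtain ⟨θ, hqr, hdom, hθ, h𝔪, hϖc⟩ := exists_sectionFrame_of_span_eq_forall O q s hs hreg ϖ hϖ c hcI hdim
  haveI := hdom
  have hι : ∀ b : O, ((Scheme.ΓSpecIso (.of O)).inv ≫ q.appTop ≫ P.presheaf.Γgerm (s (IsLocalRing.closedPoint O))).hom b =
      (P.presheaf.Γgerm (s (IsLocalRing.closedPoint O))).hom (q.appTop.hom ((Scheme.ΓSpecIso (.of O)).inv.hom b)) :=
    fun b => rfl
  -- the cone ideal and its stalk
  have hK := stalkIdeal_coneIdeal (s (IsLocalRing.closedPoint O)) (Ideal.span {MvPolynomial.eval c (MvPolynomial.map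
    ((Scheme.ΓSpecIso (.of O)).inv ≫ q.appTop ≫ P.presheaf.Γgerm (s (IsLocalRing.closedPoint O))).hom Φ₀)})
  -- hypotheses of the kit
  have hΦd : (MvPolynomial.map ((Scheme.ΓSpecIso (.of O)).inv ≫ q.appTop ≫
      P.presheaf.Γgerm (s (IsLocalRing.closedPoint O))).hom Φ₀).IsHomogeneous d := hΦ₀d.map _
  have hΦ𝔪 := map_residue_map_ne_zero O ((Scheme.ΓSpecIso (.of O)).inv ≫ q.appTop ≫
      P.presheaf.Γgerm (s (IsLocalRing.closedPoint O))).hom hΦ₀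
  have hI𝔪 : Ideal.span (Set.range c) ≤ maximalIdeal _ := h𝔪 ▸ le_sup_left
  have hΦ := map_mk_ne_zero_of_map_residue_ne_zero hI𝔪 hΦ𝔪
  have hϖ𝔪 : (P.presheaf.Γgerm (s (IsLocalRing.closedPoint O))).hom (q.appTop.hom ((Scheme.ΓSpecIso (.of O)).inv.hom ϖ)) ∈
      maximalIdeal _ := h𝔪 ▸ Ideal.mem_sup_right (Ideal.mem_span_singleton_self _)
  -- the retraction `ρ = θ ∘ mk` of `ι`
  have hρι : (θ.toRingHom.comp (Ideal.Quotient.mk (Ideal.span (Set.range c)))).comp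
      ((Scheme.ΓSpecIso (.of O)).inv ≫ q.appTop ≫ P.presheaf.Γgerm (s (IsLocalRing.closedPoint O))).hom = RingHom.id O := by
    ext b
    simp only [RingHom.comp_apply, RingHom.id_apply, hι]
    exact hθ b
  have hregΔ := hΔ _ hρι
  refine ⟨?_, ?_, ?_, hK⟩
  · refine isRegular_carrierDelta_subscheme O q s hs τ hτ _ c hcI hqr _ hΦd hΦ hK ϖ hϖ𝔪 θ fun j 𝔓 _ h𝔓 => ?_
    rw [hθ] at h𝔓
    exact hregΔ j 𝔓 h𝔓
  · exact flat_carrierDelta_subschemeι_comp O q s hs τ hτ _ c hcI hqr _ hΦd hK ϖ hϖ h𝔪 hϖc hΦ𝔪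
  · intro x hx
    have h := support_strictTransformIdeal_sup_comap_subset τ s.ker _ hx
    rwa [Scheme.IdealSheafData.support_comap, Closeds.coe_preimage]

/-- The same at a NAMED point `p` with `s(s₀) = p` (e.g. `p = j x` for the special-fibre embedding `j`, as in
HΔ(AdmTC)): all data are taken at `p`. [folklore] -/
theorem carrierDelta_clauses_of_coneForm' {P X₁ : Scheme.{0}} [IsLocallyNoetherian P] (q : P ⟶ Spec (.of O))
    [IsProper q] (s : Spec (.of O) ⟶ P) (hs : s ≫ q = 𝟙 _) (p : P) (hp : s (IsLocalRing.closedPoint O) = p)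
    (hreg : IsRegularLocalRing (P.presheaf.stalk p))
    (τ : X₁ ⟶ P) (hτ : IsBlowup τ s.ker) (ϖ : O) (hϖ : Irreducible ϖ) {n : ℕ}
    (c : Fin n → P.presheaf.stalk p)
    (hcI : Ideal.span (Set.range c) = stalkIdeal s.ker p)
    (hdim : ringKrullDim (P.presheaf.stalk p) = (n + 1 : ℕ))
    {d : ℕ} (Φ₀ : MvPolynomial (Fin n) O) (hΦ₀d : Φ₀.IsHomogeneous d)
    (hΦ₀ : MvPolynomial.map (IsLocalRing.residue O) Φ₀ ≠ 0)
    (hΔ : ∀ (ρ : P.presheaf.stalk p →+* O),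
      ρ.comp ((Scheme.ΓSpecIso (.of O)).inv ≫ q.appTop ≫ P.presheaf.Γgerm p).hom =
        RingHom.id O →
      ∀ (j : Fin n) (Q : Ideal (MvPolynomial {l : Fin n // l ≠ j} O ⧸ Ideal.span {MvPolynomial.map ρ
        (dehomogenize j (MvPolynomial.map
          ((Scheme.ΓSpecIso (.of O)).inv ≫ q.appTop ≫ P.presheaf.Γgerm p).hom Φ₀))}))
        [Q.IsPrime],
        Ideal.Quotient.mk _ (MvPolynomial.C ϖ : MvPolynomial {l : Fin n // l ≠ j} O) ∈ Q →
          IsRegularLocalRing (Localization.AtPrime Q)) :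
    Scheme.IsRegular (strictTransformIdeal τ s.ker
        (Spec.map (CommRingCat.ofHom (Ideal.Quotient.mk (Ideal.span {MvPolynomial.eval c (MvPolynomial.map
          ((Scheme.ΓSpecIso (.of O)).inv ≫ q.appTop ≫ P.presheaf.Γgerm p).hom Φ₀)}))) ≫
          P.fromSpecStalk p).ker ⊔ s.ker.comap τ).subscheme ∧
      Flat ((strictTransformIdeal τ s.ker
        (Spec.map (CommRingCat.ofHom (Ideal.Quotient.mk (Ideal.span {MvPolynomial.eval c (MvPolynomial.map
          ((Scheme.ΓSpecIso (.of O)).inv ≫ q.appTop ≫ P.presheaf.Γgerm p).hom Φ₀)}))) ≫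
          P.fromSpecStalk p).ker ⊔ s.ker.comap τ).subschemeι ≫ τ ≫ q) ∧
      (((strictTransformIdeal τ s.ker
        (Spec.map (CommRingCat.ofHom (Ideal.Quotient.mk (Ideal.span {MvPolynomial.eval c (MvPolynomial.map
          ((Scheme.ΓSpecIso (.of O)).inv ≫ q.appTop ≫ P.presheaf.Γgerm p).hom Φ₀)}))) ≫
          P.fromSpecStalk p).ker ⊔ s.ker.comap τ).support : Set X₁) ⊆
        ((s.ker.comap τ).support : Set X₁)) ∧
      stalkIdeal (Spec.map (CommRingCat.ofHom (Ideal.Quotient.mk (Ideal.span {MvPolynomial.eval c (MvPolynomial.map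
          ((Scheme.ΓSpecIso (.of O)).inv ≫ q.appTop ≫ P.presheaf.Γgerm p).hom Φ₀)}))) ≫
          P.fromSpecStalk p).ker p =
        Ideal.span {MvPolynomial.eval c (MvPolynomial.map
          ((Scheme.ΓSpecIso (.of O)).inv ≫ q.appTop ≫ P.presheaf.Γgerm p).hom Φ₀)} := by
  subst hp
  exact carrierDelta_clauses_of_coneForm O q s hs hreg τ hτ ϖ hϖ c hcI hdim Φ₀ hΦ₀d hΦ₀ hΔ

end Summit.ResolutionOfSingularities.ResolutionOfSingularities.Cruxes.EquisingularLiftNat.Sections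

end
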